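import Summits.BirchSwinnertonDyer.BirchSwinnertonDyer.Theorems.AdditiveBranchIMCGordTwoRankOneUnitSlice
import Summits.BirchSwinnertonDyer.Rank1Residual.Additive.CensusQ6CoeffValuation
import HarnessLib

/-!
# Route `AdditiveBranchIMC` (rung K1), crux `GordTwoRankOne` (item 19358): the LOWER-HALF DEFECT at a
# certified pair is at most `v_p(A′)` — `ord_p #Ш(E)_an ≤ ord_p #Ш(E) + v_p(A′)` on every (G-ord, `e = 2`)
# rank-one row with `A′ ≠ 0`, from published facts alone (sequel of `…GordTwoRankOneUnitSlice.lean`;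
# cell `bsd-addord`, seat `bsd-addord-k1-c3` gen 4; `--supports stmt-BirchSwinnertonDyer-19358 --as helper`)

HONEST FRAMING. THEOREMS ONLY: no definition, no named fact, no `sorry`, nothing booked; BSD is not proved by any
of this; the crux stays OPEN at class level. The unit-slice file showed: with the kernel `p`-adic Gross–Zagier
identity `A′·log_p γ = u·q·Reg_p(E,Dh)` (`L′(E,1) = q·Ω_E·Reg_∞`) the cofactor of the typed input
`CycLowerBoundAt W p Dh` is `c = [T¹]fE·u·A′⁻¹`, a `p`-adic integer when `‖A′‖_p = 1`. In general
`v_p(c) = v_p([T¹]fE) − v_p(A′) ≥ −v_p(A′)`, and the same bookkeeping against Delbourgo 2002 Thm. (B♮)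
(`LeadingTermClausesIntrinsic`, `ℓ`-invariant intrinsic) gives the GRADED statement

  `#Ш(E)_an = s ∈ ℚ` with `ord_p s ≤ ord_p #Ш(E) + v_p(A′)`

at every (G-ord, `e = 2`) pair of analytic rank `1` with `A′ ≠ 0`, non-CM, every odd `p` — from gen 0's PUBLISHED
binders (`hMaz`, `hCyc`/`hCyc3`, `hArt`, `h73`, `hWald`, `hDel`/`hDel3`, `hmod`, `hmodD`, `hmodN`, `hGZK`) and the
census-record certificate `CensusQ6.GordCoeffValAt W p 1 v` (`‖A′‖_p = p^{−v}` at every good-ordinary twist model; the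
engines' number). At `v = 0` it is the unit-slice theorem (the lower half itself); at `v ≥ 1` (content rows)
it bounds how far the row can be from the lower half WITHOUT any Λ-adic input: e.g. on a `v_p(A′) = 1` row the
`p`-part of `#Ш_an/#Ш` is at most `p`. §1 the class-agnostic core; §2 the cell forms per parity; §3 all odd `p`.

NOT claimed: the lower half on content rows; the upper half; any booking; the certificate is per pair.

References: [Delbourgo2002] Thm. (A), (B) (p. 40), p. 67 (iv), p. 69; [Disegni2017] Thm. A, B; [Mazur1972Towers]
Cor. 5.15; [MazurTateTeitelbaum1986Invent] §I.13–14; [Miller2011LMS] Def. 1.1; HOME/k1-c3/CERT-ROADS-19358-g4.md.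
-/

set_option autoImplicit false
set_option linter.dupNamespace false

noncomputable section

open scoped Classical MatrixGroups ModularForm NumberField

open CongruenceSubgroup WeierstrassCurve NumberField IsDedekindDomain Field
  Literature.NumberTheory.EllipticCurves Literature.NumberTheory.EllipticCurves.ModularForms
  Literature.NumberTheory.EllipticCurves.GreenbergVatsal2000
  Literature.NumberTheory.EllipticCurves.Rank1Residual
  Literature.NumberTheory.EllipticCurves.Rank1Residual.Typed
  Literature.NumberTheory.EllipticCurves.Delbourgo2002
  Literature.NumberTheory.EllipticCurves.Disegni2017
  Literature.NumberTheory.GaloisRepresentations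
  Summit.BirchSwinnertonDyer.Rank1Residual.AdditivePotMult
  Summit.BirchSwinnertonDyer.Rank1Residual.Additive

namespace Summit.BirchSwinnertonDyer.BirchSwinnertonDyer.Theorems.AdditiveBranchIMCGordTwoRankOne

variable {W : WeierstrassCurve ℚ} [W.IsElliptic] [W.IsGloballyMinimal] {p : ℕ} [hp : Fact p.Prime]

/-! ### §1 The core: the defect of the lower half is at most `v_p(A′)` -/

omit [W.IsGloballyMinimal] in
/-- **CORE (class-agnostic, rank one): `ord_p #Ш_an ≤ ord_p #Ш + v_p(a)` from ONE identity with `a ≠ 0`.**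
`W` globally minimal, `p` odd, `r_an = 1` (GZK), a height datum `Dh` with Delbourgo's (B♮) clauses
(`LeadingTermClausesIntrinsic`), `X(E/ℚ_∞)` torsion for every cyclotomic datum (`hA`), a place `v ∣ p` with
`c_v(E) ≠ 0` and `p ∤ [E(ℚ_p) : N_∞ E(ℚ_p)]` whenever finite (`hι`), and the identity `a·log_p γ = u·q·Reg_p(E,Dh)`,
`L′(E,1) = q·Ω_E·Reg_∞`, with `a ≠ 0`: then `#Ш(E)_an = s ∈ ℚ` with `ord_p s ≤ ord_p #Ш(E) + v_p(a)`. Mechanism: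
Schneider for `Dh` from the identity; for a generator `fE` of `char_Λ X(E/ℚ_∞)`, (B♮) reads
`[T¹]fE·log_p γ·#tors² = u′·(ι/c_v)·#Ш[p^∞]·Reg_p·∏c_ℓ`; multiply by `a`, substitute `a·log_p γ = u·q·Reg_p`, cancel
`Reg_p ≠ 0`: `[T¹]fE·u·q·#tors²·c_v = u′·ι·#Ш[p^∞]·∏c_ℓ·a`; valuations with `v_p([T¹]fE) ≥ 0`, `v_p(ι) = 0`, `v_p(c_v) ≥ 0`.
[cite: Delbourgo2002, Theorem (A), (B) (p. 40), p. 67 (iv), p. 69] [cite: Mazur1972Towers, Cor. 5.15 with Remark (p. 229)]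
[cite: Miller2011LMS, Def. 1.1] -/
theorem exists_shaAn_padicValRat_le_add_valuation_of_identity
    (hGZK : rank_eq_analyticRank_of_analyticRank_le_one) (hr : W.analyticRank = 1) (hp2 : p ≠ 2)
    {Dh : PAdicHeightData W p} (hBι : LeadingTermClausesIntrinsic W p Dh)
    (hA : ∀ (κ : ZpExtension ℚ p) (γ : Field.absoluteGaloisGroup ℚ),
      κ.IsCyclotomic → κ.IsTopGenerator γ → ∀ D : W.SelmerDualData κ γ, D.IsTorsion)
    (v : HeightOneSpectrum (𝓞 ℚ)) (hv : (p : 𝓞 ℚ) ∈ v.asIdeal) (hcp : W.tamagawaNumberAt v ≠ 0)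
    (hι : ∀ κ : ZpExtension ℚ p, κ.IsCyclotomic →
      localUniversalNormIndex (W := W) (v.adicCompletion ℚ) κ ⊤ ≠ 0 →
      ¬ p ∣ localUniversalNormIndex (W := W) (v.adicCompletion ℚ) κ ⊤)
    {u : ℤ_[p]ˣ} {q : ℚ} {a : ℚ_[p]}
    (hlead : W.leadingLCoeff = (q : ℂ) * (W.realPeriodRat : ℂ) * (W.regulator : ℂ))
    (hid : a * padicLog p (cyclotomicGenerator p) = ((u : ℤ_[p]) : ℚ_[p]) * (q : ℚ_[p]) * padicRegulator Dh)
    (ha0 : a ≠ 0) :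
    ∃ s : ℚ, shaAn W = (s : ℂ) ∧ padicValRat p s ≤ (padicValNat p W.shaOrder : ℤ) + a.valuation := by
  -- adapted from `exists_shaAn_padicValRat_le_of_cycLowerBound_intrinsic` (GordCycLowerBoundIntrinsic)
  have hpP : p.Prime := hp.out
  have hSch : SchneiderConjecture Dh := by
    rw [SchneiderConjecture]
    exact padicRegulator_ne_zero_of_twisted_identity hp2 ha0 hid
  -- Gross–Zagier–Kolyvagin: `rank = 1`, `Ш` finite
  obtain ⟨hrk, hfin⟩ := hGZK W (by rw [hr])
  have hmw : W.mordellWeilRank = 1 := by rw [hrk, hr]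
  haveI : Finite W.sha := hfin
  have hfinp : Finite (AddCommGroup.primaryComponent W.sha p) := inferInstance
  -- the cyclotomic setting, a dual datum, a generator of the characteristic ideal
  obtain ⟨κ, hκ, γ, hγ, hγ'⟩ := exists_isCyclotomic_isTopGenerator_isCyclotomicVariable_holds p
  obtain ⟨D⟩ := W.nonempty_selmerDualData_holds κ γ hγ
  haveI : Module.Finite (IwasawaAlgebra p) D.X := D.module_finite_holds hγ
  haveI : (Module.charIdeal (IwasawaAlgebra p) D.X).IsPrincipal := charIdeal_isPrincipal_holds p D.X
  obtain ⟨fE, hchar⟩ := Submodule.IsPrincipal.principal (Module.charIdeal (IwasawaAlgebra p) D.X)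
  have hchar' : D.charIdeal = Ideal.span {fE} := hchar
  have hX : D.IsTorsion := hA κ γ hκ hγ D
  -- Delbourgo 2002 (B), clause 3, intrinsic currency
  obtain ⟨hιpos, u', hBeq⟩ := (hBι κ γ hκ hγ hγ' D hX fE hchar' v hv).2.2 hSch hfinp
  rw [hmw, pow_one] at hBeq
  -- abbreviations in `ℚ_p`
  set ι : ℕ := localUniversalNormIndex (W := W) (v.adicCompletion ℚ) κ ⊤ with hι_def
  set F : ℚ_[p] := ((PowerSeries.coeff 1 fE : ℤ_[p]) : ℚ_[p]) with hF_def
  set L : ℚ_[p] := padicLog p (cyclotomicGenerator p) with hL_def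
  set T2 : ℚ_[p] := (W.torsionOrder : ℚ_[p]) ^ 2 with hT2_def
  set Shp : ℚ_[p] := (Nat.card (AddCommGroup.primaryComponent W.sha p) : ℚ_[p]) with hShp_def
  set Rg : ℚ_[p] := padicRegulator Dh with hRg_def
  set Cc : ℚ_[p] := (W.tamagawaProduct : ℚ_[p]) with hCc_def
  set Cp : ℚ_[p] := (W.tamagawaNumberAt v : ℚ_[p]) with hCp_def
  set uQ : ℚ_[p] := ((u : ℤ_[p]) : ℚ_[p]) with huQ_def
  set u'Q : ℚ_[p] := ((u' : ℤ_[p]) : ℚ_[p]) with hu'Q_def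
  -- non-vanishing
  have hu0 : uQ ≠ 0 := coe_units_ne_zero p u
  have hu'0 : u'Q ≠ 0 := coe_units_ne_zero p u'
  have hιne : ι ≠ 0 := hιpos.ne'
  have hι0 : (ι : ℚ_[p]) ≠ 0 := by exact_mod_cast hιne
  have hShp0 : Shp ≠ 0 := by rw [hShp_def]; exact_mod_cast Nat.card_pos.ne'
  have hCc0 : Cc ≠ 0 := by
    rw [hCc_def]; exact_mod_cast (W.tamagawaProduct_pos_holds : 0 < W.tamagawaProduct).ne'
  have hCp0 : Cp ≠ 0 := by rw [hCp_def]; exact_mod_cast hcp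
  have hT0 : W.torsionOrder ≠ 0 := (W.torsionOrder_pos_holds).ne'
  have hT2 : T2 ≠ 0 := by rw [hT2_def]; exact pow_ne_zero 2 (by exact_mod_cast hT0)
  have hRg0 : Rg ≠ 0 := hSch
  -- `F · u · q · T2 · Cp · Rg = u′ · ι · Shp · Cc · a · Rg`
  have key : F * uQ * (q : ℚ_[p]) * T2 * Cp * Rg = u'Q * (ι : ℚ_[p]) * Shp * Cc * a * Rg := by
    calc F * uQ * (q : ℚ_[p]) * T2 * Cp * Rg = F * (uQ * (q : ℚ_[p]) * Rg) * T2 * Cp := by ring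
      _ = F * (a * L) * T2 * Cp := by rw [← hid]
      _ = (F * L * T2) * Cp * a := by ring
      _ = u'Q * ((ι : ℚ_[p]) / Cp) * (Shp * Rg * Cc) * Cp * a := by rw [hBeq]
      _ = u'Q * (ι : ℚ_[p]) * Shp * Cc * a * Rg := by field_simp
  have key2 : F * uQ * (q : ℚ_[p]) * T2 * Cp = u'Q * (ι : ℚ_[p]) * Shp * Cc * a :=
    mul_right_cancel₀ hRg0 key
  have hrhs : u'Q * (ι : ℚ_[p]) * Shp * Cc * a ≠ 0 :=
    mul_ne_zero (mul_ne_zero (mul_ne_zero (mul_ne_zero hu'0 hι0) hShp0) hCc0) ha0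
  have hlhs : F * uQ * (q : ℚ_[p]) * T2 * Cp ≠ 0 := by rw [key2]; exact hrhs
  have hF0 : F ≠ 0 := fun h ↦ hlhs (by rw [h]; ring)
  have hqQ : ((q : ℚ) : ℚ_[p]) ≠ 0 := fun h ↦ hlhs (by rw [h]; ring)
  have hq0 : q ≠ 0 := fun h ↦ hqQ (by rw [h, Rat.cast_zero])
  -- valuations
  have hval := congrArg Padic.valuation key2
  rw [Padic.valuation_mul (mul_ne_zero (mul_ne_zero (mul_ne_zero hF0 hu0) hqQ) hT2) hCp0,
    Padic.valuation_mul (mul_ne_zero (mul_ne_zero hF0 hu0) hqQ) hT2,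
    Padic.valuation_mul (mul_ne_zero hF0 hu0) hqQ, Padic.valuation_mul hF0 hu0,
    Padic.valuation_mul (mul_ne_zero (mul_ne_zero (mul_ne_zero hu'0 hι0) hShp0) hCc0) ha0,
    Padic.valuation_mul (mul_ne_zero (mul_ne_zero hu'0 hι0) hShp0) hCc0,
    Padic.valuation_mul (mul_ne_zero hu'0 hι0) hShp0, Padic.valuation_mul hu'0 hι0,
    huQ_def, hu'Q_def, valuation_coe_units_eq_zero, valuation_coe_units_eq_zero, zero_add, add_zero,
    Padic.valuation_ratCast, hT2_def,
    Padic.valuation_pow, Padic.valuation_natCast, hCp_def, Padic.valuation_natCast,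
    Padic.valuation_natCast, hShp_def, Padic.valuation_natCast, padicValNat_card_addPrimaryComponent,
    hCc_def, Padic.valuation_natCast] at hval
  have hFnn : 0 ≤ F.valuation := PadicInt.valuation_coe_nonneg
  have hι0v : padicValNat p ι = 0 := padicValNat.eq_zero_of_not_dvd (hι κ hκ hιne)
  have hCpnn : (0 : ℤ) ≤ padicValRat p (W.tamagawaNumberAt v : ℚ) := by
    rw [padicValRat.of_nat]; exact Nat.cast_nonneg _
  -- the analytic order of `Ш`
  set s : ℚ := q * (W.torsionOrder : ℚ) ^ 2 / (W.tamagawaProduct : ℚ) with hs_def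
  refine ⟨s, shaAn_eq_of_leadingLCoeff_eq W hlead, ?_⟩
  have hTq : (W.torsionOrder : ℚ) ≠ 0 := by exact_mod_cast hT0
  have hPq : (W.tamagawaProduct : ℚ) ≠ 0 := by
    exact_mod_cast (W.tamagawaProduct_pos_holds : 0 < W.tamagawaProduct).ne'
  rw [hs_def, padicValRat.div (mul_ne_zero hq0 (pow_ne_zero 2 hTq)) hPq,
    padicValRat.mul hq0 (pow_ne_zero 2 hTq), padicValRat.pow, padicValRat.of_nat,
    padicValRat.of_nat, WeierstrassCurve.shaOrder]
  rw [hι0v] at hval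
  push_cast at hval ⊢
  linarith

/-- The valuation of a `p`-adic number of norm `p^{−v}` is `v`. [folklore] -/
theorem valuation_eq_of_norm_eq_zpow {a : ℚ_[p]} {v : ℤ} (ha : ‖a‖ = (p : ℝ) ^ (-v)) :
    a ≠ 0 ∧ a.valuation = v := by
  have hp1 : (1 : ℝ) < p := by exact_mod_cast hp.out.one_lt
  have ha0 : a ≠ 0 := by
    intro h
    rw [h, norm_zero] at ha
    exact (zpow_pos (zero_lt_one.trans hp1) _).ne' ha.symm
  refine ⟨ha0, ?_⟩
  have h := Padic.norm_eq_zpow_neg_valuation ha0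
  rw [ha] at h
  have := zpow_right_injective₀ (zero_lt_one.trans hp1) hp1.ne' h
  linarith

/-! ### §2 Cell (G-ord, `e = 2`), per parity: `ord_p #Ш_an ≤ ord_p #Ш + v_p(A′)` from published facts + the record -/

/-- **Cell (G-ord, `e = 2`), `p ≡ 1 (mod 4)`, non-CM, `r_an = 1`, ANY residual image, anomalous or not:
`#Ш(E)_an = s` with `ord_p s ≤ ord_p #Ш(E) + v`**, where `v = v_p(A′)` is the census record
`CensusQ6.GordCoeffValAt W p 1 v` (`‖ϖ·[T¹]L_p(f_V, α_V, ω^{(p−1)/2})‖_p = p^{−v}` at every good-ordinary twist model).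
Published binders as in `cellGordTwo_missingLowerBoundAt_rankOne_of_facts_of_unitCoeffOne`; gen 0's
`exists_datum_identity_of_facts`, then §1. [cite: Delbourgo2002, Theorem (A), (B) (p. 40), p. 67 (iv), p. 69]
[cite: Mazur1972Towers, Cor. 5.15] [cite: Disegni2017, Theorem A/B (arXiv v3 PDF 7–9)] [cite: Miller2011LMS, Def. 1.1] -/
theorem cellGordTwo_shaAn_padicValRat_le_add_rankOne_of_facts_of_coeffVal
    (hMaz : Mazur1972.cor515_universalNormIndex) (hCyc : delbourgoDatum_cycLineGrossZagier)
    (hArt : rankinSelbergEulerProductHecke_baseChangeDirichlet_eq) (h73 : GrossZagier1986_thm_I_7_3)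
    (hWald : waldspurger_exists_heegnerField_twist_ne_zero) (hDel : Delbourgo2002.mainTheorem)
    (hmod : hasEntireLFunction_rat) (hmodD : nonempty_modularParametrizationData)
    (hmodN : exists_isNewformOf) (hGZK : rank_eq_analyticRank_of_analyticRank_le_one)
    (hc : N10.CellGordTwo W p) (hp4 : p % 4 = 1) (hcm : ¬ W.HasCM) (hr : W.analyticRank = 1)
    {v : ℤ} (hval : CensusQ6.GordCoeffValAt W p 1 v) :
    ∃ s : ℚ, shaAn W = (s : ℂ) ∧ padicValRat p s ≤ (padicValNat p W.shaOrder : ℤ) + v := by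
  obtain ⟨hp2, haddv, hG, he⟩ := hc
  have hp5 : 5 ≤ p := by have := hp.out.two_le; omega
  have hev : Even (p / 2) := ⟨p / 4, by omega⟩
  obtain ⟨V, iV, iVm, C, hV, hC⟩ := TypeGOrd.exists_goodOrd_pStar_twist_model W p hp2 hG haddv he
  haveI : NeZero (V.conductorNorm ℤ) := ⟨(V.conductorNorm_pos_holds).ne'⟩
  obtain ⟨Dm⟩ := hmodD V
  obtain ⟨ϖ, -, hϖ, -⟩ := Dm.exists_rat_mul_realPeriodRat_eq_plusPeriod
  obtain ⟨Dh, hBι, -, u, q, hlead, hpgz⟩ := exists_datum_identity_of_facts hCyc hArt h73 hWald hmod hmodD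
    hmodN hGZK haddv hG hp4 hcm hr V C hV hC Dm.isNewformOf ϖ hϖ
  have ha : ‖(ϖ : ℚ_[p]) *
      PowerSeries.coeff 1 (padicLFunctionBranch Dm.f ((unitRoot V p : ℤ_[p]) : ℚ_[p]) (p / 2))‖ =
        (p : ℝ) ^ (-v) := by
    have h1 := hval V C hC ⟨hV.1, hV.2⟩ Dm.f Dm.isNewformOf ϖ (by rw [if_pos hev]; exact hϖ)
    rwa [if_pos hev, PowerSeries.coeff_C_mul] at h1
  obtain ⟨ha0, hav⟩ := valuation_eq_of_norm_eq_zpow ha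
  set v₀ : HeightOneSpectrum (𝓞 ℚ) := (Rat.HeightOneSpectrum.primesEquiv (R := 𝓞 ℚ)).symm ⟨p, hp.out⟩
    with hv₀_def
  have hv₀ : (p : 𝓞 ℚ) ∈ v₀.asIdeal := natCast_mem_asIdeal_of_primesEquiv_eq (primesEquiv_symm_apply_coe p)
  have hcp0 : W.tamagawaNumberAt v₀ ≠ 0 := (tamagawaNumberAt_ne_zero_and_le_four_of_addv W p haddv).1
  have hι : ∀ κ : ZpExtension ℚ p, κ.IsCyclotomic →
      localUniversalNormIndex (W := W) (v₀.adicCompletion ℚ) κ ⊤ ≠ 0 →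
      ¬ p ∣ localUniversalNormIndex (W := W) (v₀.adicCompletion ℚ) κ ⊤ :=
    fun κ hκ h0 ↦ UniversalNormTwist.not_dvd_localUniversalNormIndex_of_goodOrd_twist V W κ v₀ hMaz hp2
      hV.1 (by exact_mod_cast hV.2) hκ hv₀ hC h0
  rw [← hav]
  exact exists_shaAn_padicValRat_le_add_valuation_of_identity hGZK hr hp2 hBι
    (fun κ' γ hκ' hγ D ↦ hDel.isTorsion hp5 hcm haddv hG hκ' hγ D) v₀ hv₀ hcp0 hι hlead hpgz ha0

/-- **Cell (G-ord, `e = 2`), `p ≡ 3 (mod 4)`, `p ≥ 7`, non-CM, `r_an = 1`: `ord_p #Ш(E)_an ≤ ord_p #Ш(E) + v`**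
for the record `CensusQ6.GordCoeffValAt W p 1 v` (minus symbols). Odd twin of the previous theorem (gen 0's
`exists_datum_identity_odd_of_facts`). [cite: Delbourgo2002, Theorem (A), (B) (p. 40), p. 67 (iv), p. 69]
[cite: Mazur1972Towers, Cor. 5.15] [cite: Disegni2017, Theorem A/B] [cite: MazurTateTeitelbaum1986Invent, §I.13]
[cite: Miller2011LMS, Def. 1.1] -/
theorem cellGordTwo_shaAn_padicValRat_le_add_rankOne_odd_of_facts_of_coeffVal
    (hMaz : Mazur1972.cor515_universalNormIndex) (hCyc : delbourgoDatum_cycLineGrossZagier)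
    (hArt : rankinSelbergEulerProductHecke_baseChangeDirichlet_eq) (h73 : GrossZagier1986_thm_I_7_3)
    (hWald : waldspurger_exists_heegnerField_twist_ne_zero) (hDel : Delbourgo2002.mainTheorem)
    (hmod : hasEntireLFunction_rat) (hmodD : nonempty_modularParametrizationData)
    (hmodN : exists_isNewformOf) (hGZK : rank_eq_analyticRank_of_analyticRank_le_one)
    (hc : N10.CellGordTwo W p) (hp4 : p % 4 = 3) (hp5 : 5 ≤ p) (hcm : ¬ W.HasCM)
    (hr : W.analyticRank = 1) {v : ℤ} (hval : CensusQ6.GordCoeffValAt W p 1 v) :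
    ∃ s : ℚ, shaAn W = (s : ℂ) ∧ padicValRat p s ≤ (padicValNat p W.shaOrder : ℤ) + v := by
  obtain ⟨hp2, haddv, hG, he⟩ := hc
  have hodd : ¬ Even (p / 2) := fun ⟨k, hk⟩ ↦ by omega
  obtain ⟨V, iV, iVm, C, hV, hC⟩ := TypeGOrd.exists_goodOrd_pStar_twist_model W p hp2 hG haddv he
  haveI : NeZero (V.conductorNorm ℤ) := ⟨(V.conductorNorm_pos_holds).ne'⟩
  obtain ⟨Dm⟩ := hmodD V
  obtain ⟨ϖ, -, hϖ⟩ := exists_rat_mul_imaginaryPeriodRat_eq_minusPeriod Dm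
  obtain ⟨Dh, hBι, -, u, q, hlead, hpgz⟩ := exists_datum_identity_odd_of_facts hCyc hArt h73 hWald hmod
    hmodD hmodN hGZK haddv hG hp4 hp5 hcm hr V C hV hC Dm.isNewformOf ϖ hϖ
  have ha : ‖(ϖ : ℚ_[p]) *
      PowerSeries.coeff 1 (padicLFunctionMinusBranch Dm.f ((unitRoot V p : ℤ_[p]) : ℚ_[p]) (p / 2))‖ =
        (p : ℝ) ^ (-v) := by
    have h1 := hval V C hC ⟨hV.1, hV.2⟩ Dm.f Dm.isNewformOf ϖ (by rw [if_neg hodd]; exact hϖ)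
    rwa [if_neg hodd, PowerSeries.coeff_C_mul] at h1
  obtain ⟨ha0, hav⟩ := valuation_eq_of_norm_eq_zpow ha
  set v₀ : HeightOneSpectrum (𝓞 ℚ) := (Rat.HeightOneSpectrum.primesEquiv (R := 𝓞 ℚ)).symm ⟨p, hp.out⟩
    with hv₀_def
  have hv₀ : (p : 𝓞 ℚ) ∈ v₀.asIdeal := natCast_mem_asIdeal_of_primesEquiv_eq (primesEquiv_symm_apply_coe p)
  have hcp0 : W.tamagawaNumberAt v₀ ≠ 0 := (tamagawaNumberAt_ne_zero_and_le_four_of_addv W p haddv).1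
  have hι : ∀ κ : ZpExtension ℚ p, κ.IsCyclotomic →
      localUniversalNormIndex (W := W) (v₀.adicCompletion ℚ) κ ⊤ ≠ 0 →
      ¬ p ∣ localUniversalNormIndex (W := W) (v₀.adicCompletion ℚ) κ ⊤ :=
    fun κ hκ h0 ↦ UniversalNormTwist.not_dvd_localUniversalNormIndex_of_goodOrd_twist V W κ v₀ hMaz hp2
      hV.1 (by exact_mod_cast hV.2) hκ hv₀ hC h0
  rw [← hav]
  exact exists_shaAn_padicValRat_le_add_valuation_of_identity hGZK hr hp2 hBι
    (fun κ' γ hκ' hγ D ↦ hDel.isTorsion hp5 hcm haddv hG hκ' hγ D) v₀ hv₀ hcp0 hι hlead hpgz ha0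

/-- **Cell (G-ord, `e = 2`) at `p = 3`, non-CM, anomalous or not, `r_an = 1`: `ord_3 #Ш(E)_an ≤ ord_3 #Ш(E) + v`**
for the record `CensusQ6.GordCoeffValAt W 3 1 v`. The `p = 3` twin (gen 0's `exists_datum_identity_three_intrinsic_of_facts`,
Delbourgo (A) at `3`). [cite: Delbourgo2002, Theorem (A), (B) (p. 40), p. 67 (iv), p. 69; Hypothesis (p. 39) second bullet]
[cite: Mazur1972Towers, Cor. 5.15] [cite: Disegni2017, Theorem A/B] [cite: Miller2011LMS, Def. 1.1] -/
theorem cellGordTwo_shaAn_padicValRat_le_add_rankOne_three_of_facts_of_coeffVal [hp3 : Fact (Nat.Prime 3)]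
    {W : WeierstrassCurve ℚ} [W.IsElliptic] [W.IsGloballyMinimal]
    (hMaz : Mazur1972.cor515_universalNormIndex) (hCyc3 : delbourgoDatum_cycLineGrossZagier_intrinsicThree)
    (hArt : rankinSelbergEulerProductHecke_baseChangeDirichlet_eq) (h73 : GrossZagier1986_thm_I_7_3)
    (hWald : waldspurger_exists_heegnerField_twist_ne_zero) (hDel3 : Delbourgo2002.mainTheorem_three)
    (hmod : hasEntireLFunction_rat) (hmodD : nonempty_modularParametrizationData)
    (hmodN : exists_isNewformOf) (hGZK : rank_eq_analyticRank_of_analyticRank_le_one)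
    (hc : N10.CellGordTwo W 3) (hcm : ¬ W.HasCM) (hr : W.analyticRank = 1)
    {v : ℤ} (hval : CensusQ6.GordCoeffValAt W 3 1 v) :
    ∃ s : ℚ, shaAn W = (s : ℂ) ∧ padicValRat 3 s ≤ (padicValNat 3 W.shaOrder : ℤ) + v := by
  obtain ⟨hp2, haddv, hG, he⟩ := hc
  have hodd : ¬ Even ((3 : ℕ) / 2) := by decide
  obtain ⟨V, iV, iVm, C, hV, hC⟩ := TypeGOrd.exists_goodOrd_pStar_twist_model W 3 hp2 hG haddv he
  haveI : NeZero (V.conductorNorm ℤ) := ⟨(V.conductorNorm_pos_holds).ne'⟩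
  obtain ⟨Dm⟩ := hmodD V
  obtain ⟨ϖ, -, hϖ⟩ := exists_rat_mul_imaginaryPeriodRat_eq_minusPeriod Dm
  obtain ⟨Dh, hBι, -, u, q, hlead, hpgz⟩ := exists_datum_identity_three_intrinsic_of_facts hCyc3 hArt h73
    hWald hmod hmodD hmodN hGZK haddv hG hcm hr V C hV hC Dm.isNewformOf ϖ hϖ
  have ha : ‖(ϖ : ℚ_[3]) *
      PowerSeries.coeff 1
        (padicLFunctionMinusBranch Dm.f ((unitRoot V 3 : ℤ_[3]) : ℚ_[3]) ((3 : ℕ) / 2))‖ =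
        ((3 : ℕ) : ℝ) ^ (-v) := by
    have h1 := hval V C hC ⟨hV.1, hV.2⟩ Dm.f Dm.isNewformOf ϖ (by rw [if_neg hodd]; exact hϖ)
    rwa [if_neg hodd, PowerSeries.coeff_C_mul] at h1
  obtain ⟨ha0, hav⟩ := valuation_eq_of_norm_eq_zpow ha
  set v₀ : HeightOneSpectrum (𝓞 ℚ) := (Rat.HeightOneSpectrum.primesEquiv (R := 𝓞 ℚ)).symm ⟨3, hp3.out⟩
    with hv₀_def
  have hv₀ : ((3 : ℕ) : 𝓞 ℚ) ∈ v₀.asIdeal :=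
    natCast_mem_asIdeal_of_primesEquiv_eq (primesEquiv_symm_apply_coe 3)
  have hcp0 : W.tamagawaNumberAt v₀ ≠ 0 := (tamagawaNumberAt_ne_zero_and_le_four_of_addv W 3 haddv).1
  have hι : ∀ κ : ZpExtension ℚ 3, κ.IsCyclotomic →
      localUniversalNormIndex (W := W) (v₀.adicCompletion ℚ) κ ⊤ ≠ 0 →
      ¬ 3 ∣ localUniversalNormIndex (W := W) (v₀.adicCompletion ℚ) κ ⊤ :=
    fun κ hκ h0 ↦ UniversalNormTwist.not_dvd_localUniversalNormIndex_of_goodOrd_twist V W κ v₀ hMaz hp2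
      hV.1 (by exact_mod_cast hV.2) hκ hv₀ hC h0
  rw [← hav]
  exact exists_shaAn_padicValRat_le_add_valuation_of_identity hGZK hr hp2 hBι
    (fun κ' γ hκ' hγ D ↦ TypeGOrd.isTorsion_three_of_delbourgo2002 hDel3 hG haddv hcm hκ' hγ D) v₀ hv₀ hcp0
    hι hlead hpgz ha0

/-! ### §3 All odd `p`: the defect bound on every certified non-CM rank-one row of the cell -/

/-- **THE GRADED UNIT SLICE: `ord_p #Ш(E)_an ≤ ord_p #Ш(E) + v_p(A′)` on every non-CM (G-ord, `e = 2`) pair of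
analytic rank `1` carrying the census record `CensusQ6.GordCoeffValAt W p 1 v` (i.e. `A′ ≠ 0` with `v_p(A′) = v`), every odd
`p`, `p = 3` anomalous or not — from published facts alone** (the twelve binders of
`gordTwoRankOne_unitSlice_of_facts_cmFree`). At `v = 0` this is the lower half (`CensusQ6.gordCoeffValAt_zero_iff`); at
`v ≥ 1` it is what the certificate alone gives on a content row, the rest being the Λ-adic children's.
[cite: Delbourgo2002, Theorem (A), (B) (p. 40), p. 67 (iv), p. 69] [cite: Mazur1972Towers, Cor. 5.15]
[cite: Disegni2017, Theorem A/B] [cite: Miller2011LMS, Def. 1.1] -/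
theorem gordTwoRankOne_defect_le_coeffVal_of_facts_cmFree
    (hMaz : Mazur1972.cor515_universalNormIndex) (hCyc : delbourgoDatum_cycLineGrossZagier)
    (hCyc3 : delbourgoDatum_cycLineGrossZagier_intrinsicThree)
    (hArt : rankinSelbergEulerProductHecke_baseChangeDirichlet_eq) (h73 : GrossZagier1986_thm_I_7_3)
    (hWald : waldspurger_exists_heegnerField_twist_ne_zero) (hDel : Delbourgo2002.mainTheorem)
    (hDel3 : Delbourgo2002.mainTheorem_three)
    (hmod : hasEntireLFunction_rat) (hmodD : nonempty_modularParametrizationData)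
    (hmodN : exists_isNewformOf) (hGZK : rank_eq_analyticRank_of_analyticRank_le_one) :
    ∀ (W : WeierstrassCurve ℚ) [W.IsElliptic] [W.IsGloballyMinimal] (p : ℕ) [Fact p.Prime] (v : ℤ),
      W.analyticRank = 1 → N10.CellGordTwo W p → ¬ W.HasCM → CensusQ6.GordCoeffValAt W p 1 v →
      ∃ s : ℚ, shaAn W = (s : ℂ) ∧ padicValRat p s ≤ (padicValNat p W.shaOrder : ℤ) + v := by
  intro W _ _ p hpF v hr hc hcm hval
  by_cases hp3 : p = 3
  · subst hp3
    exact cellGordTwo_shaAn_padicValRat_le_add_rankOne_three_of_facts_of_coeffVal hMaz hCyc3 hArt h73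
      hWald hDel3 hmod hmodD hmodN hGZK hc hcm hr hval
  · have hp5 : 5 ≤ p := hpF.out.five_le_of_ne_two_of_ne_three hc.1 hp3
    have hodd : p % 4 = 1 ∨ p % 4 = 3 := by
      obtain ⟨k, hk⟩ := hpF.out.odd_of_ne_two hc.1
      omega
    rcases hodd with h1 | h3
    · exact cellGordTwo_shaAn_padicValRat_le_add_rankOne_of_facts_of_coeffVal hMaz hCyc hArt h73 hWald hDel
        hmod hmodD hmodN hGZK hc h1 hcm hr hval
    · exact cellGordTwo_shaAn_padicValRat_le_add_rankOne_odd_of_facts_of_coeffVal hMaz hCyc hArt h73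
        hWald hDel hmod hmodD hmodN hGZK hc h3 hp5 hcm hr hval

end Summit.BirchSwinnertonDyer.BirchSwinnertonDyer.Theorems.AdditiveBranchIMCGordTwoRankOne

end
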